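import Literature.Analysis.FluidPDE.DriftMildBootstrap
import HarnessLib

/-!
# Route `GaldiLiouvilleGate`, crux `RecordZoomAncient` (stmt-NavierStokesRegularity-0894),
  line `registered` (birth skeleton, reshape r4) — stub `stub_oseenC1kappa`

**Statement (KNSS 2009, Prop. 4.1 / (4.10) with constants depending only on the bound).** For
every `m ≥ 0` there are `C₁, H` and `κ > 0` such that every field `z` on `ℝ³`, jointly continuous
and bounded by `m` on a closed slab `[a, b] × ℝ³` and satisfying the Oseen integral identity
`z(t) = e^{(t−s)Δ} z(s) − B¹_s(z, z)(t)` for all `a ≤ s < t ≤ b`, has at every time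
`t ∈ [a + 2, b]` a gradient bounded by `C₁` and `κ`-Hölder with constant `H`.

**Proof.** We take `κ = 1/2` and read everything off the tree's Hölder-space bootstrap for
drift-mild pairs (`Literature/Analysis/FluidPDE/DriftMildBootstrap.lean`, KNSS 2009 §4, (4.10)):

* clamping time to `[a, b]` (`Set.projIcc`) turns `z` into a jointly continuous, hence jointly
  measurable, field `ẑ` bounded by `m` everywhere, which agrees with `z` on `[a, b]`; since the
  Duhamel term `B¹_s(u, u)(t)` only sees `u` on `(s, t)`, `(ẑ, 0)` is a drift-mild pair with bound
  `m` on the window `(a, b)` (`IsDriftMildOn`);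
* level `0` of the bootstrap (`exists_isHolderField_zero_of_isDriftMildOn`, `δ = 1`): every slice
  `ẑ(τ)`, `τ ∈ (a + 1, b)`, is `C^{0,1/2}` with a constant `A = A(m)`;
* for `t ∈ [a + 2, b]` restart at `s = t − d` (`d = 1/2`): `z(t) = e^{dΔ}ẑ(s) − B¹_s(ẑ, ẑ)(t)`; the
  free part has `‖D e^{dΔ}ẑ(s)‖ ≤ P(m)` with a `1/2`-Hölder derivative (`heat_holder_step`), the
  Duhamel part is `C¹` with `‖DB‖ ≤ C A² d^{1/4}` and `[DB]_{1/2} ≤ C A²`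
  (`exists_duhamel_holder_step 0`), the data `ẑ(τ)`, `τ ∈ (s, t) ⊂ (a + 1, b)`, being `C^{0,1/2}`
  with constant `A`. Note that `t = b` is allowed: the restart only uses data strictly before `t`.

Sources: G. Koch, N. Nadirashvili, G. Seregin, V. Šverák, Acta Math. 203 (2009) =
arXiv:0709.3599, §4, Prop. 4.1, Remark 4.2 and the closing paragraph with (4.7)–(4.10).
-/

noncomputable section

open Set MeasureTheory Filter Topology Function Metric
open scoped ENNReal NNReal
open Literature.Analysis.FluidPDE
open Literature.Analysis.UnboundedOperators (heatExtension)

namespace Summit.NavierStokesRegularity.NavierStokesRegularity.Theorems.RecordZoomAncient.Birth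

-- the problem-side namespace `Summit.NavierStokesRegularity.NavierStokesRegularity.…` (summit =
-- problem for this single-problem summit) duplicates `NavierStokesRegularity` by design
set_option linter.dupNamespace false

/-- **The Duhamel term `B¹ₛ(u, u)(t)` only sees the data on `(s, t)`**: fields that agree slice
by slice on `(s, t)` have the same Duhamel term. [folklore] -/
private theorem oseenDuhamel_congr_Ioo {E : Type*} [NormedAddCommGroup E] [InnerProductSpace ℝ E]
    [FiniteDimensional ℝ E] [MeasurableSpace E] [BorelSpace E] {u u' : ℝ → E → E} {s t : ℝ}
    (h : ∀ τ ∈ Ioo s t, u τ = u' τ) (x : E) :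
    oseenDuhamel 1 s u u t x = oseenDuhamel 1 s u' u' t x := by
  rw [oseenDuhamel_apply, oseenDuhamel_apply]
  exact setIntegral_congr_fun measurableSet_Ioo fun τ hτ => by simp only [h τ hτ]

/-- `‖Df(x) − Df(y)‖ ≤ ‖D¹f(x) − D¹f(y)‖` (the first iterated derivative is the Fréchet derivative
read through the currying isometry; only this inequality is needed). [folklore] -/
private theorem norm_fderiv_sub_le_norm_iteratedFDeriv_one_sub {V W : Type*} [NormedAddCommGroup V]
    [NormedSpace ℝ V] [NormedAddCommGroup W] [NormedSpace ℝ W] (f : V → W) (x y : V) :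
    ‖fderiv ℝ f x - fderiv ℝ f y‖ ≤ ‖iteratedFDeriv ℝ 1 f x - iteratedFDeriv ℝ 1 f y‖ := by
  refine ContinuousLinearMap.opNorm_le_bound _ (norm_nonneg _) fun v => ?_
  have h := (iteratedFDeriv ℝ 1 f x - iteratedFDeriv ℝ 1 f y).le_opNorm (fun _ => v)
  simpa only [sub_apply, iteratedFDeriv_one_apply, Fin.prod_univ_one] using h

/-- **stub 3a″ — `stub_oseenC1kappa` (quantitative `C^{1,κ}` regularity of bounded Oseen-mild
fields, KNSS 2009 Prop. 4.1 / (4.10) with explicit dependence on the bound).** For every bound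
`m ≥ 0` there are constants `C₁, H` and an exponent `κ > 0` (here `κ = 1/2`) such that every
field `z` on `ℝ³`, jointly continuous and bounded by `m` on a closed slab `[a, b] × ℝ³` and
satisfying the Oseen integral identity `z(t) = e^{(t−s)Δ} z(s) − B¹_s(z, z)(t)` for all
`a ≤ s < t ≤ b`, has, at every time `t ∈ [a + 2, b]`, a gradient bounded by `C₁` and `κ`-Hölder
with constant `H`. See the module docstring for the proof (the tree's drift-mild bootstrap,
`DriftMildBootstrap.lean`, after clamping time to `[a, b]`). -/
theorem stub_oseenC1kappa :
    ∀ m : ℝ, 0 ≤ m → ∃ C₁ H κ : ℝ, 0 < κ ∧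
      ∀ (z : ℝ → EuclideanSpace ℝ (Fin 3) → EuclideanSpace ℝ (Fin 3)) (a b : ℝ),
        ContinuousOn (Function.uncurry z) (Set.Icc a b ×ˢ Set.univ) →
        (∀ t ∈ Set.Icc a b, ∀ x, ‖z t x‖ ≤ m) →
        (∀ s t : ℝ, a ≤ s → s < t → t ≤ b → ∀ x,
          z t x = Literature.Analysis.UnboundedOperators.heatExtension (z s) (t - s) x - oseenDuhamel 1 s z z t x) →
        ∀ t ∈ Set.Icc (a + 2) b,
          (∀ x, ‖fderiv ℝ (z t) x‖ ≤ C₁) ∧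
          (∀ x x', ‖fderiv ℝ (z t) x - fderiv ℝ (z t) x'‖ ≤ H * ‖x - x'‖ ^ κ) := by
  intro m hm
  -- the lag of the restart, `0 < d < 1`
  obtain ⟨d, hd0, hd1⟩ : ∃ d : ℝ, 0 < d ∧ d < 1 := ⟨1 / 2, by norm_num, by norm_num⟩
  -- level `0` of the bootstrap: `C^{0,1/2}` slices with constant `A = A(m)` on `(s₀ + 1, T)`
  obtain ⟨A, hA⟩ :=
    exists_isHolderField_zero_of_isDriftMildOn (E := EuclideanSpace ℝ (Fin 3)) (δ := 1) zero_lt_one hm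
  -- the Duhamel part of `C^{0,1/2}` data is `C^{1,1/2}`
  obtain ⟨Cs, -, hCs⟩ := exists_duhamel_holder_step (E := EuclideanSpace ℝ (Fin 3)) 0
  -- the free part of bounded data gains a `1/2`-Hölder derivative after time `d`
  obtain ⟨P, K, hheat⟩ : ∃ P K : ℝ, ∀ g : EuclideanSpace ℝ (Fin 3) → EuclideanSpace ℝ (Fin 3),
      IsCkBounded 0 A g →
      (∀ x, ‖iteratedFDeriv ℝ 1 (heatExtension g d) x‖ ≤ P) ∧
      (∀ x y, ‖iteratedFDeriv ℝ 1 (heatExtension g d) x - iteratedFDeriv ℝ 1 (heatExtension g d) y‖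
        ≤ K * ‖x - y‖ ^ (1 / 2 : ℝ)) :=
    ⟨_, _, fun g hg => ⟨(heat_holder_step hg hd0).1, (heat_holder_step hg hd0).2.2⟩⟩
  refine ⟨P + Cs * A ^ 2 * d ^ (1 / 4 : ℝ), K + Cs * A ^ 2, 1 / 2, by norm_num, ?_⟩
  intro z a b hz hbd hmild t ht
  have hab : a ≤ b := by linarith [ht.1, ht.2]
  -- ### the field clamped in time to `[a, b]`
  set zc : ℝ → EuclideanSpace ℝ (Fin 3) → EuclideanSpace ℝ (Fin 3) :=
    fun τ => z (Set.projIcc a b hab τ) with hzc_def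
  have hzc_eq : ∀ τ ∈ Icc a b, zc τ = z τ := fun τ hτ => by
    simp only [hzc_def, Set.projIcc_of_mem hab hτ]
  have hzc_cont : Continuous (uncurry zc) := by
    have hφ : Continuous
        fun p : ℝ × EuclideanSpace ℝ (Fin 3) => ((Set.projIcc a b hab p.1 : ℝ), p.2) :=
      (continuous_subtype_val.comp (continuous_projIcc.comp continuous_fst)).prodMk continuous_snd
    exact hz.comp_continuous hφ fun p => ⟨(Set.projIcc a b hab p.1).2, mem_univ _⟩
  have hzc_bd : ∀ τ x, ‖zc τ x‖ ≤ m := fun τ x => hbd _ (Set.projIcc a b hab τ).2 x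
  -- `(zc, 0)` is a drift-mild pair with bound `m` on the window `(a, b)`
  have hD : IsDriftMildOn a b m zc (fun _ => 0) := by
    refine ⟨hzc_cont.measurable, measurable_const, fun τ _ x => hzc_bd τ x,
      fun _ => by simpa using hm, ?_⟩
    intro s' t' hs' hs't' ht'b x
    have hsI : s' ∈ Icc a b := ⟨hs'.le, (hs't'.trans ht'b).le⟩
    have htI : t' ∈ Icc a b := ⟨(hs'.trans hs't').le, ht'b.le⟩
    have hBB : oseenDuhamel 1 s' z z t' x =
        oseenDuhamel 1 s' (fun τ y => zc τ y + (fun _ : ℝ => (0 : EuclideanSpace ℝ (Fin 3))) τ)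
          (fun τ y => zc τ y + (fun _ : ℝ => (0 : EuclideanSpace ℝ (Fin 3))) τ) t' x :=
      oseenDuhamel_congr_Ioo (fun τ hτ => by
        funext y
        simp only [hzc_eq τ ⟨(hs'.trans hτ.1).le, (hτ.2.trans ht'b).le⟩, add_zero]) x
    rw [hzc_eq t' htI, hzc_eq s' hsI, ← hBB]
    exact hmild s' t' hs'.le hs't' ht'b.le x
  -- ### the restart at `s = t - d`
  set s : ℝ := t - d with hs_def
  have has : a ≤ s := by have := ht.1; rw [hs_def]; linarith
  have hs1 : a + 1 < s := by have := ht.1; rw [hs_def]; linarith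
  have hst : s < t := by rw [hs_def]; linarith
  have hsI : s ∈ Icc a b := ⟨has, (hst.trans_le ht.2).le⟩
  have htsd : t - s = d := by rw [hs_def]; ring
  -- Hölder data on `(s, t) ⊆ (a + 1, b)` and at the restart time
  have hUs : IsHolderField 0 (1 / 2) A (zc s) := hA hD s ⟨hs1, hst.trans_le ht.2⟩
  have hUτ : ∀ τ ∈ Ioo s t, IsHolderField 0 (1 / 2) A (zc τ) := fun τ hτ =>
    hA hD τ ⟨hs1.trans hτ.1, hτ.2.trans_le ht.2⟩
  obtain ⟨hDk, hDb, hDh⟩ := hCs hst hzc_cont.measurable hUτ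
  obtain ⟨hSP, hSh⟩ := hheat (zc s) hUs.isCkBounded
  have hSk : ContDiff ℝ (1 : ℕ) (heatExtension (zc s) d) :=
    Literature.Analysis.UnboundedOperators.contDiff_heatExtension_of_bound hUs.continuous (hzc_bd s)
      hd0
  -- the representation `z t = e^{dΔ} zc(s) - B¹ₛ(zc, zc)(t)` as functions
  have hrepr : z t = heatExtension (zc s) d - fun x => oseenDuhamel 1 s zc zc t x := by
    funext x
    have h := hmild s t has hst ht.2 x
    rw [htsd, ← hzc_eq s hsI, oseenDuhamel_congr_Ioo (u' := zc)
      (fun τ hτ => (hzc_eq τ ⟨has.trans hτ.1.le, hτ.2.le.trans ht.2⟩).symm) x] at h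
    exact h
  have hI : ∀ x, iteratedFDeriv ℝ 1 (z t) x = iteratedFDeriv ℝ 1 (heatExtension (zc s) d) x -
      iteratedFDeriv ℝ 1 (fun x => oseenDuhamel 1 s zc zc t x) x := fun x => by
    rw [hrepr]
    exact iteratedFDeriv_sub_apply hSk.contDiffAt hDk.contDiffAt
  -- ### the two bounds
  refine ⟨fun x => ?_, fun x x' => ?_⟩
  · rw [← norm_iteratedFDeriv_one, hI]
    calc ‖iteratedFDeriv ℝ 1 (heatExtension (zc s) d) x -
          iteratedFDeriv ℝ 1 (fun x => oseenDuhamel 1 s zc zc t x) x‖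
        ≤ ‖iteratedFDeriv ℝ 1 (heatExtension (zc s) d) x‖ +
          ‖iteratedFDeriv ℝ 1 (fun x => oseenDuhamel 1 s zc zc t x) x‖ := norm_sub_le _ _
      _ ≤ P + Cs * A ^ 2 * (t - s) ^ (1 / 4 : ℝ) := add_le_add (hSP x) (hDb x)
      _ = P + Cs * A ^ 2 * d ^ (1 / 4 : ℝ) := by rw [htsd]
  · calc ‖fderiv ℝ (z t) x - fderiv ℝ (z t) x'‖
        ≤ ‖iteratedFDeriv ℝ 1 (z t) x - iteratedFDeriv ℝ 1 (z t) x'‖ :=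
          norm_fderiv_sub_le_norm_iteratedFDeriv_one_sub _ _ _
      _ = ‖(iteratedFDeriv ℝ 1 (heatExtension (zc s) d) x -
              iteratedFDeriv ℝ 1 (heatExtension (zc s) d) x') -
            (iteratedFDeriv ℝ 1 (fun x => oseenDuhamel 1 s zc zc t x) x -
              iteratedFDeriv ℝ 1 (fun x => oseenDuhamel 1 s zc zc t x) x')‖ := by
          rw [hI x, hI x', sub_sub_sub_comm]
      _ ≤ K * ‖x - x'‖ ^ (1 / 2 : ℝ) + Cs * A ^ 2 * ‖x - x'‖ ^ (1 / 2 : ℝ) :=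
          (norm_sub_le _ _).trans (add_le_add (hSh x x') (hDh x x'))
      _ = (K + Cs * A ^ 2) * ‖x - x'‖ ^ (1 / 2 : ℝ) := by ring

end Summit.NavierStokesRegularity.NavierStokesRegularity.Theorems.RecordZoomAncient.Birth

end
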